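import Mathlib
import HarnessLib
import Summits.QuantumAdvantage.AdviceFreeQNC0.TwistBound
import Summits.QuantumAdvantage.AdviceFreeQNC0.WindowLadderBlocks

set_option linter.dupNamespace false
set_option autoImplicit false

/-!
# DigitDial (K) — the MEMORY TRANSFER: twisted walk transfer with ONE BIT OF MEMORY (cell decomp-qadv, lens 4, g20 rev 6)

Prop-definition-free tree twin of §10a–c of the lens-4 g20 node `DigitDial`.  The tree's `TwistedTransfer` carries the walk
state `s ∈ ℤ/3` and a SITE-LOCAL phase; here the backward vector lives on `ℤ/3 × {previous bit}` and the site operator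
`(T v)(s,b) = ½(v(s+1,0) + ζ^{[b]}·η·v(s+2,1))` carries a phase `ζ` that fires only on two consecutive `1`-bits — the transfer
form of a NEAREST-NEIGHBOUR QUADRATIC phase `e_M(Σ_i q_i u_{i-1} u_i + Σ_i l_i u_i)`.
* `key_ineq`: `|a + x|² + |a + ζx|² ≤ 2(1+λ)(|a|² + |x|²)` whenever `|ζ| ≤ 1`, `|1 + ζ| ≤ 2λ`;
* `cnsq2_twAvg2_le`: the memory step contracts the squared norm by `(1+λ)/2` (so by `(1 + cos(π/M))/2 = cos²(π/(2M))` at a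
  site with `ζ = e_M(a)`, `a ≠ 0` — for EVERY modulus `M`, no coprimality: the RELATIVE phase between the two memory states is
  what contracts);
* `pathSum_eq`: the memory path sum `Σ_u Π_j f_{g+j}(s_j(u)) · Π_i qph(ζ_{g+i}, η_{g+i}, u_i, u_{i-1})` equals `2^k · TBV2`;
* `cnsq2_TBV2_le`: norm propagation along the walk.
0 sorry; axioms standard; no `instance`, no `notation`, no `native_decide`; no `def … : Prop`.
-/

noncomputable section

namespace Summit.QuantumAdvantage.QuantumAdvantage.Theorems.DigitDial

open Finset Summit.QuantumAdvantage.AdviceFreeQNC0 Literature.Computability.MetaComplexity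
open TwistedTransfer ConstBells

namespace TwistQ

open ComplexConjugate

variable {n : ℕ}

/-- Squared norm on the doubled state space `ℤ/3 × Bool`. -/
def cnsq2 (v : ZMod 3 → Bool → ℂ) : ℝ := cnsq (fun s => v s false) + cnsq (fun s => v s true)

/-- `cnsq2 ≥ 0`. -/
theorem cnsq2_nonneg (v : ZMod 3 → Bool → ℂ) : 0 ≤ cnsq2 v := add_nonneg (cnsq_nonneg _) (cnsq_nonneg _)

/-- A coordinate is bounded by the norm. -/
theorem normSq_le_cnsq2 (v : ZMod 3 → Bool → ℂ) (s : ZMod 3) (b : Bool) : ‖v s b‖ ^ 2 ≤ cnsq2 v := by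
  cases b
  · exact (normSq_le_cnsq (fun s => v s false) s).trans (le_add_of_nonneg_right (cnsq_nonneg _))
  · exact (normSq_le_cnsq (fun s => v s true) s).trans (le_add_of_nonneg_left (cnsq_nonneg _))

/-- The twisted step WITH ONE BIT OF MEMORY: a new bit `0` moves the walk state by `+1` (phase `1`, memory `false`); a new bit `1`
moves it by `+2` with phase `η`, times `ζ` if the previous bit (the memory `b`) was `1`. -/
def twAvg2 (ζ η : ℂ) (v : ZMod 3 → Bool → ℂ) : ZMod 3 → Bool → ℂ :=
  fun s b => (v (s + 1) false + (if b then ζ else 1) * (η * v (s + 2) true)) / 2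

/-- Multiplication by a real factor family (the bell signs), on the doubled space. -/
def rMul2 (d : ZMod 3 → ℝ) (v : ZMod 3 → Bool → ℂ) : ZMod 3 → Bool → ℂ := fun s b => (d s : ℂ) * v s b

/-- A real factor family bounded by `1` does not expand the norm. -/
theorem cnsq2_rMul2_le {d : ZMod 3 → ℝ} (hd : ∀ s, d s ^ 2 ≤ 1) (v : ZMod 3 → Bool → ℂ) : cnsq2 (rMul2 d v) ≤ cnsq2 v :=
  add_le_add (cnsq_rMul_le hd (fun s => v s false)) (cnsq_rMul_le hd (fun s => v s true))

/-- **The key scalar inequality**: `|a + x|² + |a + ζx|² ≤ 2(1+λ)(|a|² + |x|²)` whenever `|ζ| ≤ 1` and `|1 + ζ| ≤ 2λ`. -/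
theorem key_ineq (a x ζ : ℂ) {lam : ℝ} (hζ : ‖ζ‖ ≤ 1) (hl : ‖1 + ζ‖ ≤ 2 * lam) :
    ‖a + x‖ ^ 2 + ‖a + ζ * x‖ ^ 2 ≤ 2 * (1 + lam) * (‖a‖ ^ 2 + ‖x‖ ^ 2) := by
  have hlam : 0 ≤ lam := by have := norm_nonneg (1 + ζ); linarith
  have h1 : ‖a + x‖ ^ 2 + ‖a + ζ * x‖ ^ 2 =
      2 * ‖a‖ ^ 2 + ‖x‖ ^ 2 + ‖ζ * x‖ ^ 2 + 2 * (a * conj x * (1 + conj ζ)).re := by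
    have e1 : ‖a + x‖ ^ 2 = ‖a‖ ^ 2 + ‖x‖ ^ 2 + 2 * (a * conj x).re := by
      rw [Complex.sq_norm, Complex.sq_norm, Complex.sq_norm, Complex.normSq_add]
    have e2 : ‖a + ζ * x‖ ^ 2 = ‖a‖ ^ 2 + ‖ζ * x‖ ^ 2 + 2 * (a * conj (ζ * x)).re := by
      rw [Complex.sq_norm, Complex.sq_norm, Complex.sq_norm, Complex.normSq_add]
    have e3 : (a * conj x * (1 + conj ζ)).re = (a * conj x).re + (a * conj (ζ * x)).re := by
      rw [← Complex.add_re, map_mul]; congr 1; ring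
    rw [e1, e2, e3]; ring
  have h2 : (a * conj x * (1 + conj ζ)).re ≤ ‖a‖ * ‖x‖ * (2 * lam) := by
    refine (Complex.re_le_norm _).trans ?_
    rw [norm_mul, norm_mul, Complex.norm_conj]
    have hc : ‖1 + conj ζ‖ = ‖1 + ζ‖ := by
      rw [← Complex.norm_conj (1 + ζ), map_add, map_one]
    rw [hc]
    exact mul_le_mul_of_nonneg_left hl (by positivity)
  have h3 : ‖ζ * x‖ ^ 2 ≤ ‖x‖ ^ 2 := by
    rw [norm_mul]
    have hx := norm_nonneg x
    have : ‖ζ‖ * ‖x‖ ≤ ‖x‖ := mul_le_of_le_one_left hx hζ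
    exact pow_le_pow_left₀ (by positivity) this 2
  have h4 : 2 * (‖a‖ * ‖x‖) ≤ ‖a‖ ^ 2 + ‖x‖ ^ 2 := by nlinarith [sq_nonneg (‖a‖ - ‖x‖)]
  rw [h1]
  nlinarith [h2, h3, h4, hlam, mul_nonneg (mul_nonneg (norm_nonneg a) (norm_nonneg x)) hlam]

/-- Addition table of `ZMod 3`. -/
theorem z3_tab : ((0 : ZMod 3) + 1 = 1) ∧ ((1 : ZMod 3) + 1 = 2) ∧ ((2 : ZMod 3) + 1 = 0) ∧
    ((0 : ZMod 3) + 2 = 2) ∧ ((1 : ZMod 3) + 2 = 0) ∧ ((2 : ZMod 3) + 2 = 1) := by decide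

/-- **Per-site contraction of the memory step**: `‖T v‖² ≤ ((1+λ)/2)·‖v‖²` when `|η| ≤ 1`, `|ζ| ≤ 1`, `|1 + ζ| ≤ 2λ`. -/
theorem cnsq2_twAvg2_le {ζ η : ℂ} {lam : ℝ} (hη : ‖η‖ ≤ 1) (hζ : ‖ζ‖ ≤ 1) (hl : ‖1 + ζ‖ ≤ 2 * lam)
    (v : ZMod 3 → Bool → ℂ) : cnsq2 (twAvg2 ζ η v) ≤ (1 + lam) / 2 * cnsq2 v := by
  have hlam : 0 ≤ lam := by have := norm_nonneg (1 + ζ); linarith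
  have hsite : ∀ a w : ℂ, ‖(a + 1 * (η * w)) / 2‖ ^ 2 + ‖(a + ζ * (η * w)) / 2‖ ^ 2 ≤
      (1 + lam) / 2 * (‖a‖ ^ 2 + ‖w‖ ^ 2) := by
    intro a w
    rw [one_mul, norm_div, norm_div, Complex.norm_ofNat, div_pow, div_pow]
    have hk := key_ineq a (η * w) ζ hζ hl
    have hx : ‖η * w‖ ^ 2 ≤ ‖w‖ ^ 2 := by
      rw [norm_mul]
      have hw := norm_nonneg w
      have : ‖η‖ * ‖w‖ ≤ ‖w‖ := mul_le_of_le_one_left hw hη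
      exact pow_le_pow_left₀ (by positivity) this 2
    nlinarith
  unfold cnsq2 cnsq twAvg2
  simp only [z3_tab, if_true, if_false, Bool.false_eq_true]
  have t0 := hsite (v 1 false) (v 2 true)
  have t1 := hsite (v 2 false) (v 0 true)
  have t2 := hsite (v 0 false) (v 1 true)
  nlinarith [t0, t1, t2]

/-! ### 10b. The memory transfer vector and the path sum -/

/-- The memory backward vector: `TBV2 0 = f g` (both memories), `TBV2 (k+1) = f g · T_{ζ g, η g}(TBV2_{g+1} k)`. -/
def TBV2 (ζ η : ℕ → ℂ) (f : ℕ → ZMod 3 → ℝ) : ℕ → ℕ → ZMod 3 → Bool → ℂ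
  | g, 0 => fun s _ => (f g s : ℂ)
  | g, k + 1 => rMul2 (f g) (twAvg2 (ζ g) (η g) (TBV2 ζ η f (g + 1) k))

/-- `TBV2` with no step left. -/
theorem TBV2_zero (ζ η : ℕ → ℂ) (f : ℕ → ZMod 3 → ℝ) (g : ℕ) : TBV2 ζ η f g 0 = fun s _ => (f g s : ℂ) := rfl

/-- `TBV2` recursion. -/
theorem TBV2_succ (ζ η : ℕ → ℂ) (f : ℕ → ZMod 3 → ℝ) (g k : ℕ) :
    TBV2 ζ η f g (k + 1) = rMul2 (f g) (twAvg2 (ζ g) (η g) (TBV2 ζ η f (g + 1) k)) := rfl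

/-- The bit of `u` at natural position `i` (`false` beyond the range). -/
def bitAt {k : ℕ} (u : Fin k → Bool) (i : ℕ) : Bool := if h : i < k then u ⟨i, h⟩ else false

/-- The PREVIOUS bit: `prevN b₀ u i = u_{i-1}`, with `b₀` before position `0`. -/
def prevN {k : ℕ} (b₀ : Bool) (u : Fin k → Bool) (i : ℕ) : Bool := if i = 0 then b₀ else bitAt u (i - 1)

/-- `bitAt (b :: u') 0 = b`. -/
theorem bitAt_cons_zero {k : ℕ} (b : Bool) (u' : Fin k → Bool) : bitAt (Fin.cons b u' : Fin (k + 1) → Bool) 0 = b := by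
  unfold bitAt
  rw [dif_pos (Nat.succ_pos k)]
  rfl

/-- `bitAt (b :: u') (i+1) = bitAt u' i`. -/
theorem bitAt_cons_succ {k : ℕ} (b : Bool) (u' : Fin k → Bool) (i : ℕ) :
    bitAt (Fin.cons b u' : Fin (k + 1) → Bool) (i + 1) = bitAt u' i := by
  unfold bitAt
  by_cases hi : i < k
  · rw [dif_pos (by omega), dif_pos hi]
    rfl
  · rw [dif_neg (by omega), dif_neg hi]

/-- `prevN b₀ u 0 = b₀`. -/
theorem prevN_zero {k : ℕ} (b₀ : Bool) (u : Fin k → Bool) : prevN b₀ u 0 = b₀ := by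
  unfold prevN; rw [if_pos rfl]

/-- `prevN b₀ (b :: u') (i+1) = prevN b u' i`. -/
theorem prevN_cons_succ {k : ℕ} (b₀ b : Bool) (u' : Fin k → Bool) (i : ℕ) :
    prevN b₀ (Fin.cons b u' : Fin (k + 1) → Bool) (i + 1) = prevN b u' i := by
  unfold prevN
  rw [if_neg (Nat.succ_ne_zero i), Nat.add_sub_cancel]
  rcases Nat.eq_zero_or_pos i with rfl | hi
  · rw [if_pos rfl, bitAt_cons_zero]
  · rw [if_neg (by omega)]
    obtain ⟨j, rfl⟩ : ∃ j, i = j + 1 := ⟨i - 1, by omega⟩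
    rw [Nat.add_sub_cancel, bitAt_cons_succ]

/-- The site phase of the memory walk: `1` on a `0`-bit, `η` on a `1`-bit after a `0`, `ζ·η` on a `1`-bit after a `1`. -/
def qph (ζ η : ℂ) (bit prev : Bool) : ℂ := if bit then (if prev then ζ else 1) * η else 1

/-- **Memory path sum = memory backward vector**:
`Σ_u (Π_{j ≤ k} f_{g+j}(s + j + W_j(u))) · Π_{i<k} qph(ζ_{g+i}, η_{g+i}, u_i, u_{i-1}) = 2^k · TBV2_g k s b₀` (`u_{-1} := b₀`). -/
theorem pathSum_eq (ζ η : ℕ → ℂ) (f : ℕ → ZMod 3 → ℝ) (k : ℕ) : ∀ (g : ℕ) (s : ZMod 3) (b₀ : Bool),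
    (∑ u : Fin k → Bool, ((∏ j ∈ range (k + 1), f (g + j) (s + ((j + wtPrefix u j : ℕ) : ZMod 3)) : ℝ) : ℂ) *
        ∏ i : Fin k, qph (ζ (g + i.val)) (η (g + i.val)) (u i) (prevN b₀ u i.val)) =
      2 ^ k * TBV2 ζ η f g k s b₀ := by
  induction k with
  | zero =>
    intro g s b₀
    rw [TBV2_zero]
    simp [wtPrefix_zero]
  | succ k ih =>
    intro g s b₀
    rw [TBV2_succ]
    rw [← Fintype.sum_equiv (Fin.consEquiv fun _ : Fin (k + 1) => Bool)
      (fun p : Bool × (Fin k → Bool) => ((∏ j ∈ range (k + 1 + 1),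
        f (g + j) (s + ((j + wtPrefix (Fin.cons p.1 p.2 : Fin (k + 1) → Bool) j : ℕ) : ZMod 3)) : ℝ) : ℂ) *
        ∏ i : Fin (k + 1), qph (ζ (g + i.val)) (η (g + i.val)) ((Fin.cons p.1 p.2 : Fin (k + 1) → Bool) i)
          (prevN b₀ (Fin.cons p.1 p.2 : Fin (k + 1) → Bool) i.val))
      _ (fun p => rfl), Fintype.sum_prod_type]
    have hinner : ∀ b : Bool, (∑ u' : Fin k → Bool, ((∏ j ∈ range (k + 1 + 1),
        f (g + j) (s + ((j + wtPrefix (Fin.cons b u' : Fin (k + 1) → Bool) j : ℕ) : ZMod 3)) : ℝ) : ℂ) *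
        ∏ i : Fin (k + 1), qph (ζ (g + i.val)) (η (g + i.val)) ((Fin.cons b u' : Fin (k + 1) → Bool) i)
          (prevN b₀ (Fin.cons b u' : Fin (k + 1) → Bool) i.val)) =
        (f g s : ℂ) * qph (ζ g) (η g) b b₀ * (2 ^ k * TBV2 ζ η f (g + 1) k (s + 1 + ((b.toNat : ℕ) : ZMod 3)) b) := by
      intro b
      rw [← ih (g + 1) (s + 1 + ((b.toNat : ℕ) : ZMod 3)) b, Finset.mul_sum]
      refine Finset.sum_congr rfl fun u' _ => ?_
      rw [Finset.prod_range_succ' _ (k + 1), Fin.prod_univ_succ]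
      simp only [Fin.cons_zero, Fin.cons_succ, Fin.val_zero, add_zero, Fin.val_succ, prevN_zero, prevN_cons_succ]
      have hfac : ∀ j ∈ range (k + 1), f (g + (j + 1)) (s + (((j + 1) +
          wtPrefix (Fin.cons b u' : Fin (k + 1) → Bool) (j + 1) : ℕ) : ZMod 3)) =
          f (g + 1 + j) (s + 1 + ((b.toNat : ℕ) : ZMod 3) + ((j + wtPrefix u' j : ℕ) : ZMod 3)) := by
        intro j _
        rw [wtPrefix_cons_succ]
        congr 1
        · ring
        · push_cast; ring
      rw [Finset.prod_congr rfl hfac]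
      simp only [wtPrefix_zero, Nat.cast_zero, add_zero]
      have hg : ∀ i : Fin k, g + (i.val + 1) = g + 1 + i.val := fun i => by ring
      simp only [hg]
      push_cast
      ring
    rw [Fintype.sum_bool, hinner true, hinner false]
    simp only [Bool.toNat_true, Bool.toNat_false, Nat.cast_one, Nat.cast_zero, add_zero]
    unfold rMul2 twAvg2 qph
    simp only [if_true, Bool.false_eq_true, if_false]
    rw [show s + 1 + (1 : ZMod 3) = s + 2 from by ring]
    ring

/-! ### 10c. Norm propagation along the memory walk -/

/-- One step. -/
theorem cnsq2_TBV2_succ_le (ζ η : ℕ → ℂ) (f : ℕ → ZMod 3 → ℝ) (hf : ∀ g s, f g s ^ 2 ≤ 1) (ρ : ℕ → ℝ)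
    (hρ : ∀ g v, cnsq2 (twAvg2 (ζ g) (η g) v) ≤ ρ g ^ 2 * cnsq2 v) (g k : ℕ) :
    cnsq2 (TBV2 ζ η f g (k + 1)) ≤ ρ g ^ 2 * cnsq2 (TBV2 ζ η f (g + 1) k) := by
  rw [TBV2_succ]
  exact (cnsq2_rMul2_le (hf g) _).trans (hρ g _)

/-- Along the whole walk: `‖TBV2_g k‖² ≤ (Π_{i<k} ρ_{g+i}²) · ‖TBV2_{g+k} 0‖²`. -/
theorem cnsq2_TBV2_le (ζ η : ℕ → ℂ) (f : ℕ → ZMod 3 → ℝ) (hf : ∀ g s, f g s ^ 2 ≤ 1) (ρ : ℕ → ℝ)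
    (hρ : ∀ g v, cnsq2 (twAvg2 (ζ g) (η g) v) ≤ ρ g ^ 2 * cnsq2 v) (k : ℕ) :
    ∀ g, cnsq2 (TBV2 ζ η f g k) ≤ (∏ i ∈ range k, ρ (g + i) ^ 2) * cnsq2 (TBV2 ζ η f (g + k) 0) := by
  induction k with
  | zero => intro g; simp
  | succ k ih =>
    intro g
    have hnonneg : 0 ≤ ρ g ^ 2 := sq_nonneg _
    calc cnsq2 (TBV2 ζ η f g (k + 1)) ≤ ρ g ^ 2 * cnsq2 (TBV2 ζ η f (g + 1) k) := cnsq2_TBV2_succ_le ζ η f hf ρ hρ g k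
      _ ≤ ρ g ^ 2 * ((∏ i ∈ range k, ρ (g + 1 + i) ^ 2) * cnsq2 (TBV2 ζ η f (g + 1 + k) 0)) :=
          mul_le_mul_of_nonneg_left (ih (g + 1)) hnonneg
      _ = (∏ i ∈ range (k + 1), ρ (g + i) ^ 2) * cnsq2 (TBV2 ζ η f (g + (k + 1)) 0) := by
          rw [Finset.prod_range_succ', add_zero, show g + 1 + k = g + (k + 1) from by ring]
          have : ∀ i ∈ range k, ρ (g + 1 + i) ^ 2 = ρ (g + (i + 1)) ^ 2 := fun i _ => by
            rw [show g + 1 + i = g + (i + 1) from by ring]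
          rw [Finset.prod_congr rfl this]; ring

/-- The initial (last-cut) vector has `cnsq2 ≤ 2`. -/
theorem cnsq2_TBV2_zero_le (ζ η : ℕ → ℂ) (BN : Finset ℕ) (n : ℕ) (κ τ : ZMod 3) :
    cnsq2 (TBV2 ζ η (fT BN n κ τ) n 0) ≤ 2 := by
  rw [TBV2_zero]
  unfold cnsq2
  have h := nsq_fT_last BN n κ τ
  have e : cnsq (fun s => ((fT BN n κ τ n s : ℝ) : ℂ)) = nsq (fT BN n κ τ n) := cnsq_ofReal _
  rw [e]
  linarith

end TwistQ

end Summit.QuantumAdvantage.QuantumAdvantage.Theorems.DigitDial
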